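import Summits.Ventures.WeilGRH.GL2FinitePrimeTransfer
import Summits.Ventures.WeilGRH.MinorantZetaTransferOddRungs
import Summits.Ventures.WeilGRH.KeyOneVectorPrinciple
import HarnessLib

/-!
# GRH arm (rh-explicit, venture WeilGRH / GL₂-ext): THE GL₂ LEVEL LAW — `WeilPositivityOn t ∧ 4(sinh t + t) ≤ log N`
  gives the Weil window `[-t, t]` for EVERY weight-`k` level-`N` datum with `|Λ_f(n)| ≤ 2Λ(n)`

Cell `rh-explicit`, WEIL TRACK — GRH ARM (weil-grh-2 gen6; the MINORANT method of `KeyMinorant.lean` /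
`MinorantZetaTransfer.lean` applied to the GL₂ functional `weilQuadraticGL2 k N Λf` of `WeilExplicitGL2.lean`).
`GL2FinitePrimeTransfer.lean` transferred a `ζ` rung through the primes CRUDELY
(`|2Λ(n) − Λ_f(n)| ≤ 4Λ(n)`, `|k(log n)| ≤ ‖g‖₂²`): budget `4(sinh t + t) + 8 Σ_{n<e^{2t}} Λ(n)/√n ≤ log N`, i.e.
`N ≥ 3 300 000` at `t = log 2` and `N ≥ 1.8·10⁸` at the frontier `4023/5000`.  Here the prime correction costs
NOTHING: with the datum `v(n) := Λ_f(n)/(2Λ(n))` (`|v| ≤ 1`) and the duplication inequality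
`Re ψ(k/2 + it) ≥ Re ψ(1/4 + it/2) + log 2` (`GL2BaseRungTransfer.lean`),

  `Re Q_f(g) ≥ ‖g‖₂² log N + 2·E_{0, 0, v}(g) = 2·E_{0, (log N)/2, v}(g)`

(`E` = the even KEY form of `KeyPolytope.lean`; `KeyOneVectorPrinciple.weilFinitePrimeQuadraticKey_eq_zero_key_sub_spikes`),
and the all-trivial key minorises every key with `|v| ≤ 1` (`KeyMinorant.keyMarkovForm_norm_le`, same-window
smoothing `KeyWindowDilation`), whose level-`(log N)/2` form is `≥ Re Q_ζ − P + (log N)/2·‖·‖² ≥ 0` once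
`2(sinh t + t) ≤ (log N)/2` (`MinorantZetaTransfer.keyMarkovForm_allTrivial_zero_nonneg_of_weilPositivityOn`).

**THEOREM (`weilPositivityOnGL2_of_weilPositivityOn`).** Even `k ≥ 2`, `‖Λf n‖ ≤ 2Λ(n)`, `0 < t`, `WeilPositivityOn t`,
`4(sinh t + t) ≤ log N` ⇒ `WeilPositivityOnGL2 k N Λf t`.  UNCONDITIONAL for `t ≤ 4023/5000`: named levels
`2/5 ⇒ N ≥ 27`, `(log 3)/2 ⇒ 96`, `59/100 ⇒ 132`, `log 2 ⇒ 324` (tree before: `3 300 000`), `18/25 ⇒ 420`, `3/4 ⇒ 540`,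
`4023/5000 ⇒ 900` (tree before: `180 000 000`); `(log 2)/2 ⇒ 17` is `GL2BaseRungTransfer`'s (prime-free, same law).
CONDITIONAL: `WeilPositivityOn 1 → (N ≥ 6048 ⇒ window [-1, 1])`.  Honest framing: a window-positivity statement
for the typed functional with a coefficient PARAMETER `Λf`; nothing about zeros of modular `L`-functions; above the
`ζ` frontier only implications.  Everything is PROVED; no definitions, no named facts.

## References

* H. Iwaniec, E. Kowalski, *Analytic Number Theory* (2004), §5.5 Thm 5.12 (5.45) [IwaniecKowalski2004];
  A. Weil (1952), the «lemme» p. 262 [Weil1952FormulesExplicites]; H. Yoshida (1992), §6 (6.2) [Yoshida1992].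
-/

set_option autoImplicit false

noncomputable section

open Complex Set MeasureTheory Finset
open scoped Real ComplexConjugate ArithmeticFunction.vonMangoldt

namespace Summit.Ventures.WeilGRH

open Literature.NumberTheory.LFunctions Literature.Analysis.SpecialFunctions.Complex
open Summit.RiemannHypothesis.RiemannHypothesis.Theorems.WeilFormatC

variable {g : ℝ → ℂ}

/-! ## The all-trivial key minorises every key with `|v| ≤ 1` (test-function level) -/

/-- **Key-level consumer of the minorant**: if the all-trivial key form of parity `a` and level `L₀` is `≥ 0` at
every test function on `[-b, b]` (`b > 0`), then for every datum `v` with `‖v n‖ ≤ 1`, every level `L ≥ L₀` and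
every test function `g` on `[-b, b]`: `0 ≤ keyMarkovForm a L v b g` (minorant at `|g|`, Lipschitz on `ℝ`; a
negative value would smooth to a test function with negative all-trivial form). [folklore] -/
theorem keyMarkovForm_nonneg_of_allTrivial_test_nonneg {a : ℕ} {L₀ L b : ℝ} (hb : 0 < b)
    (hpos : ∀ h : ℝ → ℂ, IsWeilTest h → tsupport h ⊆ Icc (-b) b → 0 ≤ keyMarkovForm a L₀ (fun _ ↦ 1) b h)
    {v : ℕ → ℂ} (hv : ∀ n, ‖v n‖ ≤ 1) (hL : L₀ ≤ L) (hg : IsWeilTest g) (hsupp : tsupport g ⊆ Icc (-b) b) :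
    0 ≤ keyMarkovForm a L v b g := by
  have hmin := keyMarkovForm_norm_le_of_level_le hb.le (isWindowFunction_of_isWeilTest hg hsupp) a hL hv b
  refine le_trans ?_ hmin
  by_contra hneg
  obtain ⟨K, hK⟩ := exists_lipschitz_norm_of_isWeilTest hg
  have hlt : keyMarkovForm a L₀ (fun _ ↦ 1) b (fun x ↦ ((‖g x‖ : ℝ) : ℂ)) <
      0 * ∫ x, ‖(((‖g x‖ : ℝ) : ℂ))‖ ^ 2 := by
    rw [zero_mul]
    exact not_le.1 hneg
  obtain ⟨h', hh', hsupp', hlt'⟩ := exists_isWeilTest_keyMarkovForm_lt_of_lipschitz hb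
    (isWindowFunction_norm (isWindowFunction_of_isWeilTest hg hsupp)) hK a L₀ (fun _ ↦ 1) hlt
  rw [zero_mul] at hlt'
  exact absurd (hpos h' hh' hsupp') (not_le.2 hlt')

/-! ## The GL₂ prime sum is twice the spike sum of the key `v = Λ_f/(2Λ)` -/

/-- `‖Λ_f(n)/(2Λ(n))‖ ≤ 1` under the coefficient bound `‖Λ_f(n)‖ ≤ 2Λ(n)`. [folklore] -/
private theorem norm_halfDatum_le {Λf : ℕ → ℂ} (hΛ : ∀ n, ‖Λf n‖ ≤ 2 * Λ n) (n : ℕ) :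
    ‖(if (Λ n : ℝ) = 0 then (0 : ℂ) else Λf n / (2 * ((Λ n : ℝ) : ℂ)))‖ ≤ 1 := by
  split_ifs with h0
  · simp
  · have hpos : 0 < (Λ n : ℝ) := lt_of_le_of_ne ArithmeticFunction.vonMangoldt_nonneg (Ne.symm h0)
    rw [norm_div, show (2 : ℂ) * ((Λ n : ℝ) : ℂ) = ((2 * Λ n : ℝ) : ℂ) by push_cast; ring, Complex.norm_real,
      Real.norm_of_nonneg (by positivity), div_le_one (by positivity)]
    exact hΛ n

/-- Termwise: `Re[(Λ_f h(ℓ) + conj Λ_f h(−ℓ))/√n] = 2·(Λ(n)/√n)·2Re(v(n) h(ℓ))` with `v = Λ_f/(2Λ)`, `h(−ℓ) = conj h(ℓ)`,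
for `k = g ⋆ g̃` and `‖Λ_f(n)‖ ≤ 2Λ(n)` (so `Λ_f(n) = 0` where `Λ(n) = 0`). [folklore] -/
private theorem gl2_term_eq (g : ℝ → ℂ) {Λf : ℕ → ℂ} (hΛ : ∀ n, ‖Λf n‖ ≤ 2 * Λ n) (n : ℕ) :
    ((Λf n * weilConv g (weilReflect g) (Real.log n) +
        conj (Λf n) * weilConv g (weilReflect g) (-Real.log n)) / (Real.sqrt n : ℂ)).re =
      2 * ((Λ n : ℝ) / Real.sqrt n *
        (2 * ((if (Λ n : ℝ) = 0 then (0 : ℂ) else Λf n / (2 * ((Λ n : ℝ) : ℂ))) *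
          weilConv g (weilReflect g) (Real.log n)).re)) := by
  set h := weilConv g (weilReflect g) with hh
  have hneg : h (-Real.log n) = conj (h (Real.log n)) := by
    rw [hh, weilConv_weilReflect_neg]
  have hsum : Λf n * h (Real.log n) + conj (Λf n) * h (-Real.log n) =
      ((2 * (Λf n * h (Real.log n)).re : ℝ) : ℂ) := by
    rw [hneg, ← map_mul, Complex.add_conj]
  rw [hsum, show ((2 * (Λf n * h (Real.log n)).re : ℝ) : ℂ) / (Real.sqrt n : ℂ) =
      (((2 * (Λf n * h (Real.log n)).re) / Real.sqrt n : ℝ) : ℂ) by push_cast; ring, Complex.ofReal_re]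
  split_ifs with h0
  · have hz : Λf n = 0 := by
      have := hΛ n
      rw [h0, mul_zero] at this
      exact norm_le_zero_iff.1 this
    simp [hz, h0]
  · have hΛc : ((Λ n : ℝ) : ℂ) ≠ 0 := by exact_mod_cast h0
    have key : (Λ n : ℝ) * (2 * ((Λf n / (2 * ((Λ n : ℝ) : ℂ))) * h (Real.log n)).re) = (Λf n * h (Real.log n)).re := by
      have : (Λf n / (2 * ((Λ n : ℝ) : ℂ))) * h (Real.log n) = (((1 / (2 * Λ n) : ℝ)) : ℂ) * (Λf n * h (Real.log n)) := by
        push_cast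
        field_simp
      rw [this, Complex.re_ofReal_mul]
      field_simp
    rw [div_mul_eq_mul_div, key.symm]
    ring

/-! ## The level law -/

/-- ★★ **THE GL₂ LEVEL LAW.**  For even `k ≥ 2`, coefficients with `‖Λf n‖ ≤ 2Λ(n)`, a window `t > 0` on which Weil
positivity for `ζ` holds, and a level with `4(sinh t + t) ≤ log N`: `WeilPositivityOnGL2 k N Λf t`.
[cite: IwaniecKowalski2004, §5.5 Thm 5.12 (5.45); Weil1952FormulesExplicites, the «lemme» p. 262; Yoshida1992, §6 eq. (6.2)] -/
theorem weilPositivityOnGL2_of_weilPositivityOn {k N : ℕ} {Λf : ℕ → ℂ} (hk : Even k) (hk2 : 2 ≤ k)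
    (hΛ : ∀ n, ‖Λf n‖ ≤ 2 * Λ n) {t : ℝ} (ht : 0 < t) (hζ : WeilPositivityOn t)
    (hN : 4 * (Real.sinh t + t) ≤ Real.log N) : WeilPositivityOnGL2 k N Λf t := by
  intro g hg hsupp
  obtain ⟨m, hkm⟩ := hk
  have hm : 1 ≤ m := by omega
  -- the window: `M = ⌊e^{2t}⌋ + 1`, `N' = M − 1`
  set N' : ℕ := ⌊Real.exp (2 * t)⌋₊ with hN'
  have hN'1 : Real.exp (2 * t) ≤ (N' : ℝ) + 1 := (Nat.lt_floor_add_one _).le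
  have hM1 : 1 ≤ N' + 1 := by omega
  have hM : 2 * t ≤ Real.log ((N' + 1 : ℕ) : ℝ) := by
    rw [Real.le_log_iff_exp_le (by positivity)]
    exact_mod_cast hN'1
  -- GL₂ side in finite-prime form
  have hQ := re_weilQuadraticGL2_eq_of_le_log (k := k) (N := N) (Λf := Λf) hg hsupp hM1 hM
  have hk2c : ∀ τ : ℝ, ((k : ℂ) / 2 + τ * I) = ((m : ℂ) + τ * I) := by
    intro τ; rw [hkm]; push_cast; ring
  simp_rw [hk2c] at hQ
  set Ng : ℝ := ∫ x : ℝ, ‖g x‖ ^ 2 with hNg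
  set A0 : ℝ := ∫ τ : ℝ, ‖weilMellin g (1 / 2 + τ * I)‖ ^ 2 * (digamma (1 / 4 + τ / 2 * I)).re with hA0
  set Am : ℝ := ∫ τ : ℝ, ‖weilMellin g (1 / 2 + τ * I)‖ ^ 2 * (digamma ((m : ℂ) + τ * I)).re with hAm
  have hA : A0 + 2 * π * Real.log 2 * Ng ≤ Am := arch_integral_quarter_add_le hg hm
  -- the prime sum is twice the spike sum of the key `v`
  set v : ℕ → ℂ := (fun n : ℕ ↦ if (Λ n : ℝ) = 0 then (0 : ℂ) else Λf n / (2 * ((Λ n : ℝ) : ℂ))) with hv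
  have hvn : ∀ n, ‖v n‖ ≤ 1 := fun n ↦ by rw [hv]; exact norm_halfDatum_le hΛ n
  have hD : (∑ n ∈ range (N' + 1), (Λf n * weilConv g (weilReflect g) (Real.log n) +
        conj (Λf n) * weilConv g (weilReflect g) (-Real.log n)) / (Real.sqrt n : ℂ)).re =
      2 * ∑ n ∈ range (N' + 1), (Λ n : ℝ) / Real.sqrt n *
        (2 * (v n * weilConv g (weilReflect g) (Real.log n)).re) := by
    rw [Complex.re_sum, Finset.mul_sum]
    refine Finset.sum_congr rfl fun n _ ↦ ?_
    rw [hv]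
    exact gl2_term_eq g hΛ n
  -- the even key form of the datum `v` at level 0
  have hE0 : weilFinitePrimeQuadraticKey 0 0 v N' g = 1 / (2 * π) * A0 - Real.log π * Ng -
      ∑ n ∈ range (N' + 1), (Λ n : ℝ) / Real.sqrt n * (2 * (v n * weilConv g (weilReflect g) (Real.log n)).re) := by
    rw [weilFinitePrimeQuadraticKey_eq_zero_key_sub_spikes hg 0 0 v N']
    have hz : ∀ τ : ℝ, weilPrimeRippleKey 0 N' τ = 0 := fun τ ↦ by
      unfold weilPrimeRippleKey; simp
    have hw : ∀ τ : ℝ, weilFinitePrimeWeightKey 0 0 0 N' τ = (digamma (1 / 4 + τ / 2 * I)).re + (-Real.log π) := by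
      intro τ
      rw [weilFinitePrimeWeightKey, hz]
      have : (1 / 4 + ((0 : ℕ) : ℂ) / 2 + (τ : ℂ) / 2 * I) = 1 / 4 + (τ : ℂ) / 2 * I := by push_cast; ring
      rw [this]
      ring
    have e : (fun τ : ℝ ↦ ‖weilMellin g (1 / 2 + τ * I)‖ ^ 2 * weilFinitePrimeWeightKey 0 0 0 N' τ) =
        fun τ : ℝ ↦ ‖weilMellin g (1 / 2 + τ * I)‖ ^ 2 * (digamma (1 / 4 + τ / 2 * I)).re +
          ‖weilMellin g (1 / 2 + τ * I)‖ ^ 2 * (-Real.log π) := by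
      funext τ
      rw [hw]
      ring
    have h0 := integrable_normSq_mul_re_digamma hg (x := 1 / 4) (by norm_num)
    have e0 : ∀ τ : ℝ, (((1 / 4 : ℝ) : ℂ) + τ / 2 * I) = 1 / 4 + (τ : ℂ) / 2 * I := by
      intro τ; push_cast; ring
    simp_rw [e0] at h0
    have hc : Integrable fun τ : ℝ ↦ ‖weilMellin g (1 / 2 + τ * I)‖ ^ 2 * (-Real.log π) :=
      (integrable_norm_sq_weilMellin_half_line hg).mul_const _
    unfold weilFinitePrimeQuadraticKey
    rw [e, integral_add h0 hc, integral_mul_const, integral_norm_sq_weilMellin_half_line hg]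
    have hNrm2 : weilNorm2Sq g = Ng := rfl
    rw [hNrm2, show (∫ τ : ℝ, ‖weilMellin g (1 / 2 + τ * I)‖ ^ 2 * (digamma (1 / 4 + τ / 2 * I)).re) = A0 from rfl]
    have hπ : (π : ℝ) ≠ 0 := Real.pi_pos.ne'
    generalize A0 = A at *
    generalize (∑ n ∈ range (N' + 1), (Λ n : ℝ) / Real.sqrt n *
      (2 * (v n * weilConv g (weilReflect g) (Real.log n)).re)) = Ssum
    field_simp
    ring
  -- positivity of the key form at level `(log N)/2` by the minorant + the `ζ` window
  have hkey : 0 ≤ weilFinitePrimeQuadraticKey 0 (Real.log N / 2) v N' g := by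
    rw [← keyMarkovForm_eq_weilFinitePrimeQuadraticKey hg hsupp hN'1 (a := 0) (Nat.zero_le _)]
    refine keyMarkovForm_nonneg_of_allTrivial_test_nonneg ht
      (fun h hh hs ↦ keyMarkovForm_allTrivial_zero_nonneg_of_weilPositivityOn hζ le_rfl hh hs) hvn ?_ hg hsupp
    linarith
  have hshift := weilFinitePrimeQuadraticKey_eq_add_norm hg 0 0 (Real.log N / 2) v N'
  have hNrm : weilNorm2Sq g = Ng := rfl
  rw [hNrm] at hshift
  -- assemble
  have hπ : 0 < π := Real.pi_pos
  have hlog2π : Real.log (2 * π) = Real.log 2 + Real.log π := Real.log_mul (by norm_num) hπ.ne'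
  rw [hQ, hD, hlog2π]
  have hq : 1 / π * Am ≥ 1 / π * (A0 + 2 * π * Real.log 2 * Ng) := mul_le_mul_of_nonneg_left hA (by positivity)
  have hq2 : 1 / π * (A0 + 2 * π * Real.log 2 * Ng) = 2 * (1 / (2 * π) * A0) + 2 * Real.log 2 * Ng := by
    field_simp
  rw [hshift] at hkey
  rw [hE0] at hkey
  nlinarith [hkey, hq, hq2]

/-- The level law with an INTEGER floor: `WeilPositivityOn t`, `4(sinh t + t) ≤ log N₀`, `N₀ ≤ N`. [folklore] -/
theorem weilPositivityOnGL2_of_weilPositivityOn_of_le {k N : ℕ} {Λf : ℕ → ℂ} (hk : Even k) (hk2 : 2 ≤ k)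
    (hΛ : ∀ n, ‖Λf n‖ ≤ 2 * Λ n) {t : ℝ} (ht : 0 < t) (hζ : WeilPositivityOn t) {N₀ : ℕ}
    (hN₀ : 4 * (Real.sinh t + t) ≤ Real.log N₀) (hle : N₀ ≤ N) : WeilPositivityOnGL2 k N Λf t := by
  have hpos : 0 < 4 * (Real.sinh t + t) := by have := Real.sinh_pos_iff.2 ht; positivity
  have h1 : 1 < N₀ := by
    by_contra h
    have : (N₀ : ℝ) ≤ 1 := by exact_mod_cast not_lt.1 h
    have := Real.log_nonpos (Nat.cast_nonneg N₀) this
    linarith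
  refine weilPositivityOnGL2_of_weilPositivityOn hk hk2 hΛ ht hζ (hN₀.trans ?_)
  exact Real.log_le_log (by exact_mod_cast (show 0 < N₀ by omega)) (by exact_mod_cast hle)

/-- ★★ **Unconditional GL₂ level law up to the `ζ` frontier** (`EvenWinsBeyondArch.weilPositivityOn_of_le_8046`).
[cite: IwaniecKowalski2004, §5.5 Thm 5.12 (5.45)] -/
theorem weilPositivityOnGL2_of_le_frontier_of_le {k N : ℕ} {Λf : ℕ → ℂ} (hk : Even k) (hk2 : 2 ≤ k)
    (hΛ : ∀ n, ‖Λf n‖ ≤ 2 * Λ n) {t : ℝ} (ht : 0 < t) (htf : t ≤ 4023 / 5000) {N₀ : ℕ}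
    (hN₀ : 4 * (Real.sinh t + t) ≤ Real.log N₀) (hle : N₀ ≤ N) : WeilPositivityOnGL2 k N Λf t :=
  weilPositivityOnGL2_of_weilPositivityOn_of_le hk hk2 hΛ ht
    (Summit.RiemannHypothesis.RiemannHypothesis.Theorems.EvenWinsBeyondArch.weilPositivityOn_of_le_8046 htf) hN₀ hle

/-! ## Named levels (twice the character floors' budgets) -/

/-- `4(sinh t + t) ≤ log N₀` at the rungs: `2/5 → 27`, `(log 3)/2 → 96`, `59/100 → 132`, `log 2 → 324`, `18/25 → 420`,
`3/4 → 540`, `4023/5000 → 900`, `1 → 6048`. [folklore] -/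
theorem gl2_level_budgets :
    4 * (Real.sinh (2 / 5) + 2 / 5) ≤ Real.log (27 : ℕ) ∧
    4 * (Real.sinh (Real.log 3 / 2) + Real.log 3 / 2) ≤ Real.log (96 : ℕ) ∧
    4 * (Real.sinh (59 / 100) + 59 / 100) ≤ Real.log (132 : ℕ) ∧
    4 * (Real.sinh (Real.log 2) + Real.log 2) ≤ Real.log (324 : ℕ) ∧
    4 * (Real.sinh (18 / 25) + 18 / 25) ≤ Real.log (420 : ℕ) ∧
    4 * (Real.sinh (3 / 4) + 3 / 4) ≤ Real.log (540 : ℕ) ∧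
    4 * (Real.sinh (4023 / 5000) + 4023 / 5000) ≤ Real.log (900 : ℕ) ∧
    4 * (Real.sinh 1 + 1) ≤ Real.log (6048 : ℕ) := by
  have h25 := two_mul_sinh_add_two_fifths_le_log
  have h3 := two_mul_sinh_add_log_three_half_le_log
  have h59 := two_mul_sinh_add_fiftynine_le_log
  have hl2 := two_mul_sinh_add_log_two_le_log
  have h72 := two_mul_sinh_add_eighteen_twentyfifths_le_log
  have h75 := two_mul_sinh_add_three_quarters_le_log
  have hfr := two_mul_sinh_add_frontier_le_log
  have h1 := two_mul_sinh_add_one_le_log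
  have s72 := sinh_le_of_exp_le exp_eighteen_twentyfifths_le
  have s75 := sinh_le_of_exp_le exp_three_quarters_le
  have s59 := sinh_le_of_exp_le exp_fiftynine_hundredths_le
  have sfr := sinh_le_of_exp_le (exp_frontier_bounds).2
  have s1 := sinh_le_of_exp_le Real.exp_one_lt_d9.le
  have hl2v := Real.log_two_gt_d9
  have hl2u := Real.log_two_lt_d9
  have hl3v := Real.log_three_gt_d9
  have hl5v := Real.log_five_gt_d9
  have h7 := log_seven_ge_quarter
  have s25 := sinh_le_of_exp_le exp_two_fifths_le
  push_cast at *
  refine ⟨?_, ?_, ?_, ?_, ?_, ?_, ?_, ?_⟩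
  · rw [show (27 : ℝ) = 3 ^ 3 by norm_num, Real.log_pow]; push_cast
    rw [show (6 : ℝ) = 2 * 3 by norm_num, Real.log_mul (by norm_num) (by norm_num)] at h25
    nlinarith
  · rw [show (96 : ℝ) = 2 ^ 5 * 3 by norm_num, Real.log_mul (by norm_num) (by norm_num), Real.log_pow]; push_cast
    rw [show (10 : ℝ) = 2 * 5 by norm_num, Real.log_mul (by norm_num) (by norm_num)] at h3
    have s3 := sinh_le_of_exp_le exp_log_three_half_le
    nlinarith [Real.log_three_lt_d9]
  · rw [show (132 : ℝ) = 2 ^ 2 * 3 * 11 by norm_num, Real.log_mul (by norm_num) (by norm_num),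
      Real.log_mul (by norm_num) (by norm_num), Real.log_pow]; push_cast
    have h11 : (3 * Real.log 2 + Real.log 3 + Real.log 5) / 2 ≤ Real.log 11 := by
      have h : Real.log 120 ≤ Real.log 121 := Real.log_le_log (by norm_num) (by norm_num)
      rw [show (120 : ℝ) = 2 ^ 3 * 3 * 5 by norm_num, show (121 : ℝ) = 11 ^ 2 by norm_num,
        Real.log_mul (by norm_num) (by norm_num), Real.log_mul (by norm_num) (by norm_num), Real.log_pow,
        Real.log_pow] at h
      push_cast at h
      linarith
    nlinarith
  · rw [show (324 : ℝ) = 2 ^ 2 * 3 ^ 4 by norm_num, Real.log_mul (by norm_num) (by norm_num), Real.log_pow,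
      Real.log_pow]; push_cast
    rw [sinh_log_two]
    nlinarith
  · rw [show (420 : ℝ) = 2 ^ 2 * 3 * 5 * 7 by norm_num, Real.log_mul (by norm_num) (by norm_num),
      Real.log_mul (by norm_num) (by norm_num), Real.log_mul (by norm_num) (by norm_num), Real.log_pow]; push_cast
    nlinarith
  · rw [show (540 : ℝ) = 2 ^ 2 * 3 ^ 3 * 5 by norm_num, Real.log_mul (by norm_num) (by norm_num),
      Real.log_mul (by norm_num) (by norm_num), Real.log_pow, Real.log_pow]; push_cast
    nlinarith
  · rw [show (900 : ℝ) = 2 ^ 2 * 3 ^ 2 * 5 ^ 2 by norm_num, Real.log_mul (by norm_num) (by norm_num),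
      Real.log_mul (by norm_num) (by norm_num), Real.log_pow, Real.log_pow, Real.log_pow]; push_cast
    nlinarith
  · rw [show (6048 : ℝ) = 2 ^ 5 * 3 ^ 3 * 7 by norm_num, Real.log_mul (by norm_num) (by norm_num),
      Real.log_mul (by norm_num) (by norm_num), Real.log_pow, Real.log_pow]; push_cast
    nlinarith

/-- ★ **`t = log 2` for every GL₂ datum of level `N ≥ 324`** (even `k ≥ 2`, `‖Λf n‖ ≤ 2Λ(n)`; the tree's earlier
floor was `3 300 000`). [cite: IwaniecKowalski2004, §5.5 Thm 5.12 (5.45)] -/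
theorem weilPositivityOnGL2_log_two_of_ge_324 {k N : ℕ} {Λf : ℕ → ℂ} (hk : Even k) (hk2 : 2 ≤ k)
    (hΛ : ∀ n, ‖Λf n‖ ≤ 2 * Λ n) (hN : 324 ≤ N) : WeilPositivityOnGL2 k N Λf (Real.log 2) :=
  weilPositivityOnGL2_of_le_frontier_of_le hk hk2 hΛ (Real.log_pos (by norm_num)) (by linarith [Real.log_two_lt_d9])
    gl2_level_budgets.2.2.2.1 hN

/-- ★ **The `ζ` frontier `4023/5000` for every GL₂ datum of level `N ≥ 900`** (tree before: `180 000 000`).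
[cite: IwaniecKowalski2004, §5.5 Thm 5.12 (5.45)] -/
theorem weilPositivityOnGL2_frontier_of_ge_900 {k N : ℕ} {Λf : ℕ → ℂ} (hk : Even k) (hk2 : 2 ≤ k)
    (hΛ : ∀ n, ‖Λf n‖ ≤ 2 * Λ n) (hN : 900 ≤ N) : WeilPositivityOnGL2 k N Λf (4023 / 5000) :=
  weilPositivityOnGL2_of_le_frontier_of_le hk hk2 hΛ (by norm_num) le_rfl gl2_level_budgets.2.2.2.2.2.2.1 hN

/-- ★ `3/4` for level `N ≥ 540`; `18/25` for `N ≥ 420`; `59/100` for `N ≥ 132`; `(log 3)/2` for `N ≥ 96`; `2/5` for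
`N ≥ 27`. [cite: IwaniecKowalski2004, §5.5 Thm 5.12 (5.45)] -/
theorem weilPositivityOnGL2_rungs {k N : ℕ} {Λf : ℕ → ℂ} (hk : Even k) (hk2 : 2 ≤ k)
    (hΛ : ∀ n, ‖Λf n‖ ≤ 2 * Λ n) :
    (540 ≤ N → WeilPositivityOnGL2 k N Λf (3 / 4)) ∧ (420 ≤ N → WeilPositivityOnGL2 k N Λf (18 / 25)) ∧
      (132 ≤ N → WeilPositivityOnGL2 k N Λf (59 / 100)) ∧
      (96 ≤ N → WeilPositivityOnGL2 k N Λf (Real.log 3 / 2)) ∧ (27 ≤ N → WeilPositivityOnGL2 k N Λf (2 / 5)) := by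
  obtain ⟨b25, b3, b59, -, b72, b75, -, -⟩ := gl2_level_budgets
  exact ⟨fun h ↦ weilPositivityOnGL2_of_le_frontier_of_le hk hk2 hΛ (by norm_num) (by norm_num) b75 h,
    fun h ↦ weilPositivityOnGL2_of_le_frontier_of_le hk hk2 hΛ (by norm_num) (by norm_num) b72 h,
    fun h ↦ weilPositivityOnGL2_of_le_frontier_of_le hk hk2 hΛ (by norm_num) (by norm_num) b59 h,
    fun h ↦ weilPositivityOnGL2_of_le_frontier_of_le hk hk2 hΛ (by linarith [Real.log_three_gt_d9])
      (by linarith [Real.log_three_lt_d9]) b3 h,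
    fun h ↦ weilPositivityOnGL2_of_le_frontier_of_le hk hk2 hΛ (by norm_num) (by norm_num) b25 h⟩

/-- **CONDITIONAL `t = 1`**: `WeilPositivityOn 1 →` window `[-1, 1]` for every GL₂ datum of level `N ≥ 6048`.
An implication only. [cite: IwaniecKowalski2004, §5.5 Thm 5.12 (5.45)] -/
theorem weilPositivityOnGL2_one_of_weilPositivityOn_one {k N : ℕ} {Λf : ℕ → ℂ} (hk : Even k) (hk2 : 2 ≤ k)
    (hΛ : ∀ n, ‖Λf n‖ ≤ 2 * Λ n) (hζ : WeilPositivityOn 1) (hN : 6048 ≤ N) : WeilPositivityOnGL2 k N Λf 1 :=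
  weilPositivityOnGL2_of_weilPositivityOn_of_le hk hk2 hΛ one_pos hζ gl2_level_budgets.2.2.2.2.2.2.2 hN

end Summit.Ventures.WeilGRH

end
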